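import Literature.MathematicalPhysics.QuantumFieldTheory.Balaban1983to89.B9Thm31SiteGsqHessianReg335Y

/-!
# `Balaban1983to89.B9Thm31SiteGsqHessianLocalityReg335Y` — T. Bałaban, *Propagators for lattice gauge theories in a background field*, Commun. Math. Phys. **99** (1985)
# 389–434 [Balaban1985BackgroundPropagators] (3.46) p. 398, Cor 3.6 p. 408, (3.88) p. 409 («supp h_□ ⊂ □̃»), with [B6] = [Balaban1984PropagatorsII] (2.46) p. 231:
# **LOCALITY OF THE SECOND-ORDER MEMBER `M_hG′_□M_h∇*_ν∇*_μ` AND ITS BLOCK-TO-BLOCK SHAPE WITH AN HONEST CONSTANT** — the output lives on `supp h`, the input is read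
# on the backward stencil of `supp h`; hence for `D ⊇ supp h` of block diameter `R₀` the consumer's shape `Σ_{z∈t}HS ≤ C·e^{2δ(R₀+2)}e^{−2δd(t,s)}‖λ‖²` (every `δ ≥ 0`)
# from the GLOBAL bound `C` of file 28 (file 29 of width seat `pub-ymgap-dag-n06-w1`'s set; what dag-n06-w7's G4 `B9Eq346SecondLegAtPinsL2` can consume today)

statement-level skeleton of published theorems with citation tags; proofs where landed; nothing here is a claim about the Yang–Mills mass gap

WHY ∕ HONEST CONSTANT.  File 28 bounds the second-order member globally (`C_H`, □-uniform, no level factor).  The walk's consumer reads it block to block with a rate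
`e^{−δd(t,s)}`; inside one □̃ (side `~M` blocks) this file supplies that shape by LOCALITY ONLY — the constant `e^{2δ(R₀+2)}` is `e^{O(δM)}`, member-uniform but NOT
print's `O(1)`: the genuine Agmon decay of the second-order member inside □̃ (print's `B₀e^{−δ₀d(y,y′)}` for the fourth∕sixth members of (3.46) at `G′_□`) is NOT typed
(the seat's HANDOFF (r2) records why the naive weighted Bochner rerun fails and what would work).  Whether `e^{O(δM)}` is admissible is the certificate's numerics' call.

WHAT IS PROVED (sorry-free; 0 `def`; any `U`, any real `h` with `supp h ⊆ D`).
* `cutMulY_apply_eq_zero_of_not_mem_supp`, ★ `sum_block_hs_cutMulY_eq_zero` (output block `t` not met by `D` ⇒ block sum `= 0`);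
* ★ `sandwich_cdsS_cdsS_eq_zero_of_far` (source `λ` on a block `s` not reached by the stencil `{z, z−e_μ, z−e_ν, z−e_ν−e_μ}` of any `z ∈ D` ⇒ the member `= 0`);
* `sum_block_hs_le_trIP_self`, `distT_stencil_le_two` (the stencil stays within block distance 2; file 24's `distT_blkOf_shiftY_symm_le_one` + [B6] (2.46)'s triangle inequality);
* ★★ `sum_block_sandwich_cdsS_cdsS_le_exp`: `D` of block diameter `≤ R₀`, `λ` on `s`, any `t`, any `δ ≥ 0`, any global bound `C` (e.g. file 28's `C_H`):
  `Σ_{z∈t} HS((M_hG′_□M_h∇*_ν∇*_μλ)(z)) ≤ C·e^{2δ(R₀+2)}·e^{−2δ·d(t,s)}·‖λ‖²`.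
HONEST SCOPE: support bookkeeping over file 28; NOT the Agmon decay of the second-order member; NOT a node discharge, NOT summit progress; count-neutral; nothing continuum ∕
OS ∕ mass gap ∕ Clay; the YM mass gap (Clay) is NOT proved by any of this — R4 closes the conditional finite-𝕋⁴ rung `BalabanLadder.UV` only.  NEW file importing file 28
only.  Net new unproved facts: 0.
-/

noncomputable section

namespace Literature.MathematicalPhysics.QuantumFieldTheory.Balaban1983to89.B9Thm31SiteGsqHessianLocalityReg335Y

open Literature.MathematicalPhysics.QuantumFieldTheory.Balaban1983to89
open Node00 B6KLevelCensusIndexV1 B6MultiLevelTorusOperator B6GlobalChartV1 B9BackgroundsKLevelV1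
  B9Eq39Adjoint B9Thm311ReadingCoords B9Thm311DeltaPrimePos B9Ineq369CurvatureSmallAtLettersY B9Thm31SiteCoerciveGaugeBlockY B9Thm31SiteGpBoundsReg335Y
  B9Thm31SiteCurvatureCommutatorsY B9Thm31SiteBochnerY B9Thm31SiteGsqHessianReg335Y
open scoped Matrix Matrix.Norms.L2Operator

variable {d ℓ : ℕ} {hd : 1 ≤ d + 1} {hL : Odd (ℓ + 1) ∧ 1 < ℓ + 1} {b₀ b₁ : ℝ}
variable (i : KIdx d ℓ hd hL b₀ b₁) {N : ℕ} {G : Subgroup (Matrix (Fin N) (Fin N) ℂ)ˣ}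

section Locality

open Literature.MathematicalPhysics.QuantumFieldTheory.Balaban1983to89.B9Thm37CubeCoverCommutators (cutMulY cutMulY_apply)
open B6Geom246MultiLevelBox B6Geom246MultiLevelTorus B6TorusSiteWalks B4TorusKernel.MultiPeriod Node00.OpsYLocalInverse B9Thm31SiteGsqBlockDistReg335Y

variable {c α₀ : ℝ}

/-- the sandwich's OUTPUT lives on `supp h ⊆ D`: `(M_hX)(z) = 0` off `D`. [cite: Balaban1985BackgroundPropagators, (3.88) p.409, bookkeeping] -/
theorem cutMulY_apply_eq_zero_of_not_mem_supp {D : Finset (SiteY i)} {h : SiteY i → ℝ} (hhD : ∀ z, z ∉ D → h z = 0)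
    (X : SiteY i → Matrix (Fin N) (Fin N) ℂ) {z : SiteY i} (hz : z ∉ D) : cutMulY h X z = 0 := by
  rw [cutMulY_apply, hhD z hz]; simp

/-- ★ **LOCALITY OF THE SECOND-ORDER MEMBER, OUTPUT SIDE**: the block sum over a block `t` not met by `D ⊇ supp h` vanishes.
[cite: Balaban1985BackgroundPropagators, (3.88) p.409 (supp h_□ ⊂ □̃), bookkeeping] -/
theorem sum_block_hs_cutMulY_eq_zero {D : Finset (SiteY i)} {h : SiteY i → ℝ} (hhD : ∀ z, z ∉ D → h z = 0) (t : BlkY i)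
    (ht : ∀ z ∈ D, blkOf i.D.toDomains z ≠ t) (X : SiteY i → Matrix (Fin N) (Fin N) ℂ) :
    ∑ z ∈ Finset.univ.filter (fun z => blkOf i.D.toDomains z = t), ∑ a, ∑ b, ‖cutMulY h X z a b‖ ^ 2 = 0 := by
  refine Finset.sum_eq_zero fun z hz => ?_
  have hzt : blkOf i.D.toDomains z = t := (Finset.mem_filter.1 hz).2
  have hzD : z ∉ D := fun hD => ht z hD hzt
  rw [cutMulY_apply_eq_zero_of_not_mem_supp i hhD X hzD]; simp

/-- ★ **LOCALITY OF THE SECOND-ORDER MEMBER, INPUT SIDE**: if the source `λ` lives on a block `s` that no site of `D` reaches within the stencil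
`{z, z−e_μ, z−e_ν, z−e_ν−e_μ}`, then `M_hG′_□M_h∇*_ν∇*_μλ = 0` identically (any `U`, any `h` supported in `D`).
[cite: Balaban1985BackgroundPropagators, (3.8) p.392, (3.88) p.409, bookkeeping] -/
theorem sandwich_cdsS_cdsS_eq_zero_of_far {U : CfgY (Matrix (Fin N) (Fin N) ℂ) i} {D : Finset (SiteY i)} {h : SiteY i → ℝ} (hhD : ∀ z, z ∉ D → h z = 0)
    (μ ν : Fin (d + 1)) (s : BlkY i) {Λ : SiteY i → Matrix (Fin N) (Fin N) ℂ} (hΛ : ∀ z, blkOf i.D.toDomains z ≠ s → Λ z = 0)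
    (hfar : ∀ z ∈ D, blkOf i.D.toDomains z ≠ s ∧ blkOf i.D.toDomains ((shiftY i μ).symm z) ≠ s ∧ blkOf i.D.toDomains ((shiftY i ν).symm z) ≠ s
      ∧ blkOf i.D.toDomains ((shiftY i μ).symm ((shiftY i ν).symm z)) ≠ s) :
    cutMulY h (GsqY i (parSymY i) D U (cutMulY h (cdsS i U ν (cdsS i U μ Λ)))) = 0 := by
  have hsrc : cutMulY h (cdsS i U ν (cdsS i U μ Λ)) = 0 := by
    funext z
    by_cases hz : z ∈ D
    · obtain ⟨h1, h2, h3, h4⟩ := hfar z hz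
      rw [cutMulY_apply, Pi.zero_apply]
      have e : cdsS i U ν (cdsS i U μ Λ) z = 0 := by
        show R (UboxY i U ν ((shiftY i ν).symm z))⁻¹ (cdsS i U μ Λ ((shiftY i ν).symm z)) - cdsS i U μ Λ z = 0
        have e1 : cdsS i U μ Λ z = 0 := by
          show R (UboxY i U μ ((shiftY i μ).symm z))⁻¹ (Λ ((shiftY i μ).symm z)) - Λ z = 0
          rw [hΛ _ h2, hΛ _ h1, R_zero, sub_zero]
        have e2 : cdsS i U μ Λ ((shiftY i ν).symm z) = 0 := by
          show R (UboxY i U μ ((shiftY i μ).symm ((shiftY i ν).symm z)))⁻¹ (Λ ((shiftY i μ).symm ((shiftY i ν).symm z))) - Λ ((shiftY i ν).symm z) = 0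
          rw [hΛ _ h4, hΛ _ h3, R_zero, sub_zero]
        rw [e1, e2, R_zero, sub_zero]
      rw [e, smul_zero]
    · exact cutMulY_apply_eq_zero_of_not_mem_supp i hhD _ hz
  rw [hsrc, map_zero, map_zero]

/-- ★★ **THE SECOND-ORDER MEMBER BLOCK TO BLOCK (no decay claimed)**: the block sum over any output block `t` is bounded by the global `C_H·‖λ‖²` of
`trIP_cutMulY_GsqY_cutMulY_cdsS_cdsS_le`; with the two locality lemmas above only pairs `(t, s)` inside one □̃ occur.
[cite: Balaban1985BackgroundPropagators, (3.46) p.398, Cor 3.6 p.408, (3.88) p.409] -/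
theorem sum_block_hs_le_trIP_self (t : BlkY i) (X : SiteY i → Matrix (Fin N) (Fin N) ℂ) :
    ∑ z ∈ Finset.univ.filter (fun z => blkOf i.D.toDomains z = t), ∑ a, ∑ b, ‖X z a b‖ ^ 2 ≤ trIP (fun _ => (1 : ℝ)) X X := by
  rw [trIP_one_self_eq]
  exact Finset.sum_le_univ_sum_of_nonneg fun z => hs_nonneg _


/-- the stencil `{z, z−e_μ, z−e_ν, z−e_ν−e_μ}` stays within block distance `2` of `blkOf z`. [cite: Balaban1984PropagatorsII, (2.46) p.231, bookkeeping] -/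
theorem distT_stencil_le_two (μ ν : Fin (d + 1)) (z : SiteY i) :
    (bondT i.D).dist (blkOf i.D.toDomains z) (blkOf i.D.toDomains ((shiftY i μ).symm z)) ≤ 2
    ∧ (bondT i.D).dist (blkOf i.D.toDomains z) (blkOf i.D.toDomains ((shiftY i ν).symm z)) ≤ 2
    ∧ (bondT i.D).dist (blkOf i.D.toDomains z) (blkOf i.D.toDomains ((shiftY i μ).symm ((shiftY i ν).symm z))) ≤ 2 := by
  obtain ⟨_, hMh, hP⟩ := B9Thm31SiteGsqBlockDistReg335Y.one_le_RMhP i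
  have h1 := B9Thm31SiteGsqBlockDistReg335Y.distT_blkOf_shiftY_symm_le_one i μ z
  have h2 := B9Thm31SiteGsqBlockDistReg335Y.distT_blkOf_shiftY_symm_le_one i ν z
  have h3 := B9Thm31SiteGsqBlockDistReg335Y.distT_blkOf_shiftY_symm_le_one i μ ((shiftY i ν).symm z)
  have htri := (connectedT (D := i.D) hMh hP).dist_triangle (u := blkOf i.D.toDomains z) (v := blkOf i.D.toDomains ((shiftY i ν).symm z))
    (w := blkOf i.D.toDomains ((shiftY i μ).symm ((shiftY i ν).symm z)))
  exact ⟨by omega, by omega, by omega⟩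

/-- ★★ **THE SECOND-ORDER MEMBER IN THE CONSUMER's BLOCK SHAPE, WITH AN HONEST CONSTANT**: if `D ⊇ supp h` has block diameter `≤ R₀`, then for a source `λ` on a
block `s`, an output block `t`, and ANY rate `δ ≥ 0`,
`Σ_{z∈t} HS((M_hG′_□M_h∇*_ν∇*_μλ)(z)) ≤ C·e^{2δ(R₀+2)}·e^{−2δ·d(t,s)}·‖λ‖²` for every `C` bounding the member globally (`C = C_H` of
`trIP_cutMulY_GsqY_cutMulY_cdsS_cdsS_le`) — because the term vanishes unless `d(t,s) ≤ R₀ + 2` (the two locality lemmas).  For □̃ of side `~M` blocks this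
constant is `e^{O(δM)}`: an honest placeholder until the Agmon decay of the second-order member inside □̃ is typed.
[cite: Balaban1985BackgroundPropagators, (3.46) p.398, Cor 3.6 p.408, (3.88) p.409; Balaban1984PropagatorsII, (2.46) p.231] -/
theorem sum_block_sandwich_cdsS_cdsS_le_exp {U : CfgY (Matrix (Fin N) (Fin N) ℂ) i} {D : Finset (SiteY i)} {h : SiteY i → ℝ}
    (hhD : ∀ z, z ∉ D → h z = 0) {R₀ : ℕ} (hR : ∀ z ∈ D, ∀ z' ∈ D, (bondT i.D).dist (blkOf i.D.toDomains z) (blkOf i.D.toDomains z') ≤ R₀)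
    (μ ν : Fin (d + 1)) (s t : BlkY i) {Λ : SiteY i → Matrix (Fin N) (Fin N) ℂ} (hΛ : ∀ z, blkOf i.D.toDomains z ≠ s → Λ z = 0)
    {C : ℝ} (hC0 : 0 ≤ C)
    (hglob : trIP (fun _ => (1 : ℝ)) (cutMulY h (GsqY i (parSymY i) D U (cutMulY h (cdsS i U ν (cdsS i U μ Λ)))))
        (cutMulY h (GsqY i (parSymY i) D U (cutMulY h (cdsS i U ν (cdsS i U μ Λ))))) ≤ C * trIP (fun _ => (1 : ℝ)) Λ Λ)
    {δ : ℝ} (hδ : 0 ≤ δ) :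
    ∑ z ∈ Finset.univ.filter (fun z => blkOf i.D.toDomains z = t), ∑ a, ∑ b,
        ‖cutMulY h (GsqY i (parSymY i) D U (cutMulY h (cdsS i U ν (cdsS i U μ Λ)))) z a b‖ ^ 2
      ≤ C * Real.exp (2 * δ * ((R₀ : ℝ) + 2)) * Real.exp (-(2 * δ * ((bondT i.D).dist t s : ℝ))) * trIP (fun _ => (1 : ℝ)) Λ Λ := by
  classical
  have hQ0 : 0 ≤ trIP (fun _ => (1 : ℝ)) Λ Λ := trIP_self_nonneg _ (fun _ => one_pos) Λ
  by_cases hnear : ∃ z ∈ D, blkOf i.D.toDomains z = t ∧ ∃ z' ∈ D, ¬ (blkOf i.D.toDomains z' ≠ s ∧ blkOf i.D.toDomains ((shiftY i μ).symm z') ≠ s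
      ∧ blkOf i.D.toDomains ((shiftY i ν).symm z') ≠ s ∧ blkOf i.D.toDomains ((shiftY i μ).symm ((shiftY i ν).symm z')) ≠ s)
  · -- both blocks meet the stencil of `D`: `d(t,s) ≤ R₀ + 2`, so the exponential factor is `≥ 1`
    obtain ⟨z, hzD, hzt, z', hz'D, hz's⟩ := hnear
    have hdist : ((bondT i.D).dist t s : ℝ) ≤ (R₀ : ℝ) + 2 := by
      obtain ⟨_, hMh, hP⟩ := B9Thm31SiteGsqBlockDistReg335Y.one_le_RMhP i
      have hzz' := hR z hzD z' hz'D
      obtain ⟨d1, d2, d3⟩ := distT_stencil_le_two i μ ν z'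
      have htri := fun (w : BlkY i) => (connectedT (D := i.D) hMh hP).dist_triangle (u := blkOf i.D.toDomains z) (v := blkOf i.D.toDomains z') (w := w)
      have hts : (bondT i.D).dist t s ≤ R₀ + 2 := by
        rw [← hzt]
        simp only [not_and_or, not_not] at hz's
        rcases hz's with e | e | e | e
        · rw [← e]; have := hzz'; omega
        · rw [← e]; have := htri (blkOf i.D.toDomains ((shiftY i μ).symm z')); omega
        · rw [← e]; have := htri (blkOf i.D.toDomains ((shiftY i ν).symm z')); omega
        · rw [← e]; have := htri (blkOf i.D.toDomains ((shiftY i μ).symm ((shiftY i ν).symm z'))); omega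
      exact_mod_cast hts
    have hexp : 1 ≤ Real.exp (2 * δ * ((R₀ : ℝ) + 2)) * Real.exp (-(2 * δ * ((bondT i.D).dist t s : ℝ))) := by
      rw [← Real.exp_add]
      exact Real.one_le_exp (by nlinarith)
    calc _ ≤ trIP (fun _ => (1 : ℝ)) (cutMulY h (GsqY i (parSymY i) D U (cutMulY h (cdsS i U ν (cdsS i U μ Λ)))))
          (cutMulY h (GsqY i (parSymY i) D U (cutMulY h (cdsS i U ν (cdsS i U μ Λ))))) := sum_block_hs_le_trIP_self i t _
      _ ≤ C * trIP (fun _ => (1 : ℝ)) Λ Λ := hglob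
      _ = C * 1 * trIP (fun _ => (1 : ℝ)) Λ Λ := by ring
      _ ≤ C * (Real.exp (2 * δ * ((R₀ : ℝ) + 2)) * Real.exp (-(2 * δ * ((bondT i.D).dist t s : ℝ)))) * trIP (fun _ => (1 : ℝ)) Λ Λ :=
          mul_le_mul_of_nonneg_right (mul_le_mul_of_nonneg_left hexp hC0) hQ0
      _ = _ := by ring
  · -- otherwise the block sum vanishes
    have hzero : ∑ z ∈ Finset.univ.filter (fun z => blkOf i.D.toDomains z = t), ∑ a, ∑ b,
        ‖cutMulY h (GsqY i (parSymY i) D U (cutMulY h (cdsS i U ν (cdsS i U μ Λ)))) z a b‖ ^ 2 = 0 := by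
      by_cases ht : ∀ z ∈ D, blkOf i.D.toDomains z ≠ t
      · exact sum_block_hs_cutMulY_eq_zero i hhD t ht _
      · simp only [not_forall, not_not, exists_prop] at ht
        obtain ⟨z, hzD, hzt⟩ := ht
        have hfar : ∀ z' ∈ D, blkOf i.D.toDomains z' ≠ s ∧ blkOf i.D.toDomains ((shiftY i μ).symm z') ≠ s
            ∧ blkOf i.D.toDomains ((shiftY i ν).symm z') ≠ s ∧ blkOf i.D.toDomains ((shiftY i μ).symm ((shiftY i ν).symm z')) ≠ s := by
          intro z' hz'D
          by_contra hcon
          exact hnear ⟨z, hzD, hzt, z', hz'D, hcon⟩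
        have hz0 : ∀ z : SiteY i, (cutMulY h (GsqY i (parSymY i) D U (cutMulY h (cdsS i U ν (cdsS i U μ Λ))))) z = 0 := fun z => by
          rw [sandwich_cdsS_cdsS_eq_zero_of_far i hhD μ ν s hΛ hfar]; rfl
        refine Finset.sum_eq_zero fun z _ => ?_
        rw [hz0 z]
        simp
    rw [hzero]
    positivity
end Locality

end Literature.MathematicalPhysics.QuantumFieldTheory.Balaban1983to89.B9Thm31SiteGsqHessianLocalityReg335Y
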